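import Summits.RiemannHypothesis.RiemannHypothesis.Theses.SignCone
import Summits.RiemannHypothesis.RiemannHypothesis.Theorems.SignConeSignConeDualityStubEngine
import Summits.RiemannHypothesis.RiemannHypothesis.Theorems.SignConeSignConeDualityStubSlater
import Summits.RiemannHypothesis.RiemannHypothesis.Theorems.SignConeSignConeDualityStubFarNode
import Summits.RiemannHypothesis.RiemannHypothesis.Theorems.SignConeSignConeDualityStubArchPolarAdd
import Summits.RiemannHypothesis.RiemannHypothesis.Theorems.SignConeSignConeDualityStubScaling
import Summits.RiemannHypothesis.RiemannHypothesis.Theorems.SignConeSignConeDualityStubMultipliers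
import Summits.RiemannHypothesis.RiemannHypothesis.Theorems.SignConeSignConeDualityStubConclusion

/-!
# `SignCone.SignConeDuality` — conic duality at each cutoff (line `Sketch`)
(crux item stmt-RiemannHypothesis-16304, route route-RiemannHypothesis-SignCone)

CONIC DUALITY AT EACH CUTOFF. Fix `a > 0` and assume the unit-slack sign-cone inequality `X_a`:
for every finite family `g : Fin k → (ℝ → ℂ)` of Weil tests supported in `[-a, a]` whose
autocorrelation sum `F = ∑ i, g i ⋆ (g i)̃` is node-nonnegative (`Re F(log n) ≥ 0` for `n ≥ 2`),
`Re W_ar(F) ≥ -Re F(0)`, where `W_ar = weilPolarTerm + weilArchTerm` is the prime-free Weil form.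
Then there is a nonnegative weight `c : ℕ → ℝ` with `c 1 = 0` such that
`Re [W_ar(G) - ∑ₙ c(n) n^{-1/2} (G(log n) + G(-log n))] ≥ -∫ ‖g‖²` for every Weil test `g`
supported in `[-a, a]`, `G = g ⋆ g̃` (a "fake von Mangoldt weight with unit slack at cutoff `a`").

Vocabulary: the item (rev 3) is spelled over Mathlib primitives and is DEFINITIONALLY the
Literature form used by the stubs (`IsWeilTest`, `weilConv g (weilReflect g)`, `weilMellin`,
`weilPolarTerm F + weilArchTerm F`); the composition below passes the hypothesis and returns the
conclusion up to `rfl` (route-repair certificate `SignConeRev3DefEq.lean`).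

Proof (idea `ratio-induction-multipliers`, crux-ideate r1 k1; the same plan independently as
`peel-one-node`, r1 k2). Only the nodes `2 ≤ n < ⌈e^{2a}⌉` are active: beyond them every
autocorrelation of a test supported in `[-a, a]` vanishes (`stub_farNode`). The image of the Weil
cone `P(a)` under the moment map `F ↦ (Re W_ar(F) + Re F(0), (Re F(log n))_n)` is closed under `+`
(append the families; `W_ar` is additive on test kernels, `stub_archPolarAdd` — the one analytic
input: integrability of the archimedean integrand) and under positive scaling (`g ↦ √r g`,
`stub_scaling`); `X_a` says "node coordinates ≥ 0 ⇒ first coordinate ≥ 0" on it; one nonnegative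
smooth bump is a Slater point (`stub_slater`). The topology-free cone-multiplier ENGINE
(`stub_engine`: Lagrange multipliers for finitely many sign constraints on a cone closed under `+`
and `ℝ_{>0}`-scaling, by the sInf-of-ratios lemma one node at a time — no Hahn–Banach, no closure,
no dual attainment) hands out `l ≥ 0` with `∑ l_n Re G(log n) ≤ Re W_ar(G) + Re G(0)`
(`stub_multipliers`), and `c(n) := l_n √n / 2` on the active nodes (`0` elsewhere, so `c 1 = 0` and
the `∑'` is finite) together with the hermitian symmetry `G(-t) = conj G(t)` and `G(0) = ∫ ‖g‖²`
gives the conclusion (`stub_conclusion`). All seven stubs are landed files of this namespace,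
imported above; this file is their composition BY NAME.
-/

noncomputable section

open scoped BigOperators ComplexConjugate
open Complex MeasureTheory Set

namespace Summit.RiemannHypothesis.RiemannHypothesis.Theorems.SignConeDuality

open Literature.NumberTheory.LFunctions

/-- **`SignCone.SignConeDuality` (crux item stmt-RiemannHypothesis-16304): conic duality at each
cutoff.** The unit-slack sign-cone inequality at cutoff `a` implies the existence of a nonnegative
weight `c` on `ℕ` (`c 1 = 0`; supported on `2 ≤ n < ⌈e^{2a}⌉`) whose fake Weil form
`W_ar − P_c` has unit slack on every Weil test supported in `[-a, a]`. Composition of the line's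
seven stubs: `stub_multipliers` (fed `stub_engine`, `stub_slater`, `stub_farNode`,
`stub_archPolarAdd`, `stub_scaling`) produces nonnegative node multipliers from the hypothesis, and
`stub_conclusion` repackages them as the weight `c`. -/
theorem signConeDuality_proof :
    Summit.RiemannHypothesis.RiemannHypothesis.Theses.SignCone.SignConeDuality := by
  unfold Summit.RiemannHypothesis.RiemannHypothesis.Theses.SignCone.SignConeDuality
  intro a ha hX
  obtain ⟨l, hl0, hl⟩ :=
    stub_multipliers stub_engine stub_slater stub_farNode stub_archPolarAdd stub_scaling a ha hX
  exact stub_conclusion a _ l hl0 hl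

/-- The line's composition under its skeleton name (`Lines/Sketch.lean`: `SignConeDuality_of`). -/
theorem SignConeDuality_of :
    Summit.RiemannHypothesis.RiemannHypothesis.Theses.SignCone.SignConeDuality :=
  signConeDuality_proof

end Summit.RiemannHypothesis.RiemannHypothesis.Theorems.SignConeDuality

end
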